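import Mathlib
import Summits.ValiantsHypothesis.ValiantsHypothesis.Theorems.FifoMatchingNNDivisionHardFewSummandsUnionTransport
import Summits.ValiantsHypothesis.ValiantsHypothesis.Theorems.FifoMatchingNNDivisionHardFewSummandsProducts
import HarnessLib

/-!
# ★★★ `NNDivisionHard` ON SUMS OF POLYNOMIALLY MANY PRODUCTS OF SPARSE FACTORS (`ΣΠ` of sparse polynomials, ANY degrees) — the
# few-summands law for unions in the crux's currency (crux `Theses.FifoMatching.NNDivisionHard`, stmt-ValiantsHypothesis-21181)

WHAT IS NEW.  ✓ `…FewSummandsProducts.nnDivisionHard_prod_sparseFactors` decides ONE product of polynomially many sparse factors.  Over `ℝ≥0`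
the support of a SUM is the UNION of the supports, so `Newt(Σ_k Π_i p_{k,i}) = conv(⋃_k Σ_i Newt p_{k,i})` — a UNION of Minkowski sums, the
shape decided at the COR level by ✓ `…FewSummandsUnion.union_summands_decided` (one-cut rung with a label count).  This file carries the
union-of-product-families shape through the located-face transport and reads the law on `NN_n`:

* (part 1, ✓ `…FewSummandsUnionTransport`: `unionFamily_face`, `transport_geometric_union`, `nn_union_fewSummands`);
* `two_pow_mul_eight_pow_le`, `labels_threshold` — `2K·8^L ≤ 9^L` for `K ≤ n^k`, eventually;
* ★★★ `nnDivisionHard_unionSummands` (abstract) and ★★★ `nnDivisionHard_sum_prod_sparseFactors` — for all `c k`, eventually in `n`: every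
  `hh = Σ_{j<K} Π_{i<M} p_{j,i}` over `ℝ≥0` with all `p_{j,i} ≠ 0`, `|supp p_{j,i}| ≤ m`, `K ≤ n^k`, `K·M·m² ≤ n^k` satisfies the crux's literal inequality
  `2^((log₂ n + c)^c) < L₊(NN_n · hh) + L₊(hh)` — ANY degrees: depth-three `ΣΠΣ`-sparse cofactors of polynomial format are not certificates.

HONEST FRAMING: a restriction theorem (a decided sub-class of cofactors), NOT the crux: stmt-21181 `NNDivisionHard` OPEN; COR-VIRTUAL OPEN;
`NNNotVP` OPEN; `VP ≠ VNP` NOT proved.  No definitions, no named facts, no sorry.  References: Hrubeš–Yehudayoff 2021 §6 Problem 2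
[HrubesYehudayoff2021]; Kaibel–Weltge 2015 [KaibelWeltge2014]; Fiorini et al. 2015 [FioriniEtAl2015]; AFHMS 2019 [AboulkerEtAl2019].
-/

set_option autoImplicit false

-- the mandated summit-side namespace repeats a component by design (single-problem summit)
set_option linter.dupNamespace false

noncomputable section

open Matrix Finset
open scoped Pointwise

namespace Summit.ValiantsHypothesis.ValiantsHypothesis.Theorems.FifoMatching

namespace Summands

open Literature.Barriers.PneNP (HasEFOfSize sum_dotProduct_le_sum_of_valid inter_eqs_eq_inter_sum_of_valid)
open Literature.Combinatorics.Optimization (corPolytopeGraph)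
open Summit.ValiantsHypothesis.ValiantsHypothesis.Theorems.FifoMatching.XcDivision
open Summit.ValiantsHypothesis.ValiantsHypothesis.Theorems.FifoMatching.LowDim (newt_inter_zeroSet_eq)
open MvPolynomial
open scoped NNReal
open Literature.Computability.AlgebraicComplexity (complexity nestFreeMatchingPoly)
open Literature.Computability.AlgebraicComplexity.MonotoneCircuitEF (hasEFOfSize_newtonPolytope_complexity)
open Literature.Algebra.Polynomial.NewtonPolytope (newtonPolytope newtonPolytope_mul)
open Summit.ValiantsHypothesis.ValiantsHypothesis.Theorems.FifoMatching.QueueGridFace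
  (realOf suppPts newt QGV patternVec queueGridPP corMap corMap_image_queueGridPP newt_nonneg)
open Summit.ValiantsHypothesis.ValiantsHypothesis.Theorems.FifoMatching.GridCorShadow (queueGridZeroOnePoints_holds)
open Summit.ValiantsHypothesis.ValiantsHypothesis.Theorems.FifoMatching.MonomialCofactor (newt_eq_newtonPolytope)
open Literature.Combinatorics.Optimization (AboulkerEtAl2019_gridCorCliqueFace)
open Summit.ValiantsHypothesis.ValiantsHypothesis.Theorems.FifoMatching.Zono (zone_params zones_threshold newtonPolytope_prod)
open Summit.ValiantsHypothesis.ValiantsHypothesis.Theorems.FifoMatching.FaceBlind (one_le_L)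

/-! ## §4 The rate and the member theorem -/

/-- `2^j · 8^L ≤ 9^L` once `6j ≤ L` (`(9/8)^6 ≥ 2`). [folklore] -/
theorem two_pow_mul_eight_pow_le (j L : ℕ) (hL : 6 * j ≤ L) : 2 ^ j * 8 ^ L ≤ 9 ^ L := by
  obtain ⟨d, rfl⟩ := Nat.exists_eq_add_of_le hL
  have h6 : ∀ j : ℕ, 2 ^ j * 8 ^ (6 * j) ≤ 9 ^ (6 * j) := by
    intro j
    induction j with
    | zero => simp
    | succ j ih =>
      have e1 : 2 ^ (j + 1) * 8 ^ (6 * (j + 1)) = (2 ^ j * 8 ^ (6 * j)) * (2 * 8 ^ 6) := by ring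
      have e2 : 9 ^ (6 * (j + 1)) = 9 ^ (6 * j) * 9 ^ 6 := by ring
      rw [e1, e2]
      exact Nat.mul_le_mul ih (by norm_num)
  calc 2 ^ j * 8 ^ (6 * j + d) = (2 ^ j * 8 ^ (6 * j)) * 8 ^ d := by ring
    _ ≤ 9 ^ (6 * j) * 9 ^ d := Nat.mul_le_mul (h6 j) (Nat.pow_le_pow_left (by norm_num) d)
    _ = 9 ^ (6 * j + d) := by ring

/-- the label threshold: `24k(ℓ+1) + 12 ≤ (ℓ + C)^C` for `C ≥ 5`, `k ≤ ℓ + 5`. [folklore] -/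
theorem labels_threshold (C k ℓ : ℕ) (hC : 5 ≤ C) (hk : k ≤ ℓ + 5) : 24 * k * (ℓ + 1) + 12 ≤ (ℓ + C) ^ C := by
  have h1 : (ℓ + 5) ^ 2 * 5 ^ 3 ≤ (ℓ + C) ^ C := by
    calc (ℓ + 5) ^ 2 * 5 ^ 3 ≤ (ℓ + C) ^ 2 * (ℓ + C) ^ 3 :=
          Nat.mul_le_mul (Nat.pow_le_pow_left (by omega) 2) (Nat.pow_le_pow_left (by omega) 3)
      _ = (ℓ + C) ^ 5 := by ring
      _ ≤ (ℓ + C) ^ C := Nat.pow_le_pow_right (by omega) hC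
  have h2 : 24 * k * (ℓ + 1) + 12 ≤ (ℓ + 5) ^ 2 * 5 ^ 3 := by nlinarith
  exact h2.trans h1

/-- ★★★ **`NNDivisionHard` ON COFACTORS WHOSE NEWTON POLYTOPE IS THE HULL OF A UNION OF `K` MINKOWSKI SUMS OF SMALL POLYTOPES (PROVED,
unconditional):** for all `c k`, eventually in `n`, every `hh ≠ 0` over `ℝ≥0` with
`Newt(hh) = conv{w j + Σ_{i<M} vtx j i (f i) : j < K, f}` (`K ≥ 1` labels, `M` summands of `m ≥ 1` listed points; ANY vectors),
`K ≤ n^k`, `K·M·m² ≤ n^k`, satisfies `2^((log₂ n + c)^c) < L₊(NN_n · hh) + L₊(hh)`. [cite: HrubesYehudayoff2021, §6 Problem 2] [cite: KaibelWeltge2014, Thm. 1] -/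
theorem nnDivisionHard_unionSummands (c k : ℕ) : ∃ n₀ : ℕ, ∀ n ≥ n₀,
    ∀ hh : MvPolynomial (Fin (2 * n) × Fin (2 * n)) ℝ≥0, hh ≠ 0 →
      ∀ {K M m : ℕ}, 1 ≤ K → 1 ≤ m → ∀ (vtx : Fin K → Fin M → Fin m → (Fin (2 * n) × Fin (2 * n)) → ℝ)
        (w : Fin K → (Fin (2 * n) × Fin (2 * n)) → ℝ),
        newtonPolytope (MvPolynomial.map NNReal.toRealHom hh) =
          convexHull ℝ (Set.range fun kf : Fin K × (Fin M → Fin m) => w kf.1 + ∑ i, vtx kf.1 i (kf.2 i)) →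
        K ≤ n ^ k → K * (M * (m * m)) ≤ n ^ k →
          2 ^ ((Nat.log 2 n + c) ^ c) < complexity (nestFreeMatchingPoly n ℝ≥0 * hh) + complexity hh := by
  obtain ⟨cA, hcA, t₀, htrans⟩ := nn_union_fewSummands
  set cm : ℝ := min cA 1 with hcm
  have hcm0 : 0 < cm := lt_min hcA one_pos
  have hcmA : cm ≤ cA := min_le_left _ _
  have hcm1 : cm ≤ 1 := min_le_right _ _
  obtain ⟨N, hN⟩ := zones_threshold (4 ^ (c + 1) + c + 1) k
  obtain ⟨S₁, hS₁⟩ := exists_nat_ge ((20 / cm) ^ 2)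
  obtain ⟨S₀, hS₀a, hS₀b, hS₀c, hS₀d, hS₀e⟩ :
      ∃ S₀ : ℕ, 4 * t₀ + 4 ≤ S₀ ∧ (2 ^ N) ^ 2 ≤ S₀ ∧ S₁ ≤ S₀ ∧ 16 ≤ S₀ ∧ (2 ^ k) ^ 2 ≤ S₀ :=
    ⟨4 * t₀ + 4 + (2 ^ N) ^ 2 + S₁ + 16 + (2 ^ k) ^ 2, by omega, by omega, by omega, by omega, by omega⟩
  refine ⟨S₀ ^ 2, fun n hn hh hh0 K M m hK hm vtx w hQ hK1 hMk => ?_⟩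
  classical
  by_contra hle
  push Not at hle
  have hEF : HasEFOfSize (newtonPolytope (MvPolynomial.map NNReal.toRealHom (nestFreeMatchingPoly n ℝ≥0)) +
      convexHull ℝ (Set.range fun kf : Fin K × (Fin M → Fin m) => w kf.1 + ∑ i, vtx kf.1 i (kf.2 i)))
      (3 * 2 ^ ((Nat.log 2 n + c) ^ c)) := by
    have h1 := hasEFOfSize_newtonPolytope_complexity (nestFreeMatchingPoly n ℝ≥0 * hh)
    rw [map_mul, newtonPolytope_mul, hQ] at h1
    exact h1.of_le (by omega)
  obtain ⟨s, hs⟩ : ∃ s, s = Nat.sqrt n := ⟨_, rfl⟩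
  have hsS : S₀ ≤ s := by rw [hs]; exact Nat.le_sqrt'.2 hn
  have hss : s ^ 2 ≤ n := by rw [hs]; exact Nat.sqrt_le' n
  have hns : n < (s + 1) ^ 2 := by rw [hs]; exact Nat.lt_succ_sqrt' n
  obtain ⟨g, hg⟩ : ∃ g, g = s / 4 := ⟨_, rfl⟩
  have h4g : 4 * g ≤ s := by rw [hg]; exact Nat.mul_div_le s 4
  have hg4 : s < 4 * (g + 1) := by rw [hg]; omega
  have hg1 : 1 ≤ g := by omega
  have hgt : t₀ ≤ g := by omega
  have hn' : (2 * g + 1) * (2 * (2 * g) + 1) ≤ n := by nlinarith [Nat.mul_le_mul h4g h4g]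
  obtain ⟨h, hch, hlaw⟩ := htrans n (2 * g) g (by omega) hn' (le_refl _) hgt hK hm vtx w _ hEF
  -- `h` is large
  have hsqrt_s : Real.sqrt s * Real.sqrt s = s := Real.mul_self_sqrt (Nat.cast_nonneg s)
  have hg_real : (s : ℝ) / 4 - 1 ≤ g := by
    have : (s : ℝ) < 4 * ((g : ℝ) + 1) := by exact_mod_cast hg4
    linarith
  have h1 : cm * ((s : ℝ) / 4 - 1) ≤ h :=
    calc cm * ((s : ℝ) / 4 - 1) ≤ cm * g := mul_le_mul_of_nonneg_left hg_real hcm0.le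
      _ ≤ cA * g := mul_le_mul_of_nonneg_right hcmA (Nat.cast_nonneg g)
      _ ≤ h := hch
  have hreal : Real.sqrt s + 1 ≤ (h : ℝ) := by
    have hS₁s : ((20 / cm) ^ 2 : ℝ) ≤ s := le_trans hS₁ (by exact_mod_cast (show S₁ ≤ s by omega))
    have hsq : 20 / cm ≤ Real.sqrt s := by
      rw [show (20 / cm : ℝ) = Real.sqrt ((20 / cm) ^ 2) by rw [Real.sqrt_sq (by positivity)]]
      exact Real.sqrt_le_sqrt hS₁s
    have h20 : 20 ≤ cm * Real.sqrt s := by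
      have := mul_le_mul_of_nonneg_left hsq hcm0.le
      rwa [show cm * (20 / cm) = 20 by field_simp] at this
    have h2 : 20 * Real.sqrt s ≤ cm * s := by
      have := mul_le_mul_of_nonneg_right h20 (Real.sqrt_nonneg s)
      rw [mul_assoc, hsqrt_s] at this
      exact this
    have hs1 : 1 ≤ Real.sqrt s := by
      rw [show (1 : ℝ) = Real.sqrt 1 by simp]
      exact Real.sqrt_le_sqrt (by exact_mod_cast (show 1 ≤ s by omega))
    nlinarith
  have hpow_le : ∀ P : ℕ, P ^ 2 ≤ s → P ≤ h := by
    intro P hP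
    have : ((P : ℕ) : ℝ) ≤ Real.sqrt s := by
      rw [show ((P : ℕ) : ℝ) = Real.sqrt (((P : ℕ) : ℝ) ^ 2) by rw [Real.sqrt_sq (Nat.cast_nonneg _)]]
      exact Real.sqrt_le_sqrt (by exact_mod_cast hP)
    exact_mod_cast (by linarith : ((P : ℕ) : ℝ) ≤ h)
  have hhN : 2 ^ N ≤ h := hpow_le _ (by omega)
  have hhk : 2 ^ k ≤ h := hpow_le _ (by omega)
  have hn4 : n < h ^ 4 := by
    have hs1 : s + 1 ≤ h ^ 2 := by
      have : (s : ℝ) + 1 ≤ (h : ℝ) ^ 2 := by nlinarith [Real.sqrt_nonneg s]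
      exact_mod_cast this
    calc n < (s + 1) ^ 2 := hns
      _ ≤ (h ^ 2) ^ 2 := Nat.pow_le_pow_left hs1 2
      _ = h ^ 4 := by rw [← pow_mul]
  have hn0 : n ≠ 0 := by
    have : 16 ^ 2 ≤ s ^ 2 := Nat.pow_le_pow_left (by omega) 2
    omega
  -- the zone parameters, the label threshold, and the law
  obtain ⟨t, ht1, hmt, hcount⟩ := zone_params (C := 4 ^ (c + 1) + c + 1) hN hhN hn4 hMk
  have hKL : 2 * K * 8 ^ ((Nat.log 2 h + (4 ^ (c + 1) + c + 1)) ^ (4 ^ (c + 1) + c + 1)) ≤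
      9 ^ ((Nat.log 2 h + (4 ^ (c + 1) + c + 1)) ^ (4 ^ (c + 1) + c + 1)) := by
    set C' : ℕ := 4 ^ (c + 1) + c + 1 with hC'
    have hC5 : 5 ≤ C' := by
      have : 4 ≤ 4 ^ (c + 1) := by
        calc 4 = 4 ^ 1 := by norm_num
          _ ≤ 4 ^ (c + 1) := Nat.pow_le_pow_right (by norm_num) (by omega)
      omega
    have hℓk : k ≤ Nat.log 2 h + 5 := by
      have := Nat.le_log_of_pow_le (b := 2) (by norm_num) hhk
      omega
    have hthr := labels_threshold C' k (Nat.log 2 h) hC5 hℓk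
    -- `2K ≤ 2 h^{4k} ≤ 2^{4k(ℓ+1)+1}` and `6(4k(ℓ+1)+1) ≤ L`
    have hhℓ : h < 2 ^ (Nat.log 2 h + 1) := Nat.lt_pow_succ_log_self (by norm_num) h
    have hK2 : K ≤ 2 ^ (4 * k * (Nat.log 2 h + 1)) := by
      calc K ≤ n ^ k := hK1
        _ ≤ (h ^ 4) ^ k := Nat.pow_le_pow_left hn4.le k
        _ ≤ (2 ^ (Nat.log 2 h + 1)) ^ (4 * k) := by rw [← pow_mul]; exact Nat.pow_le_pow_left hhℓ.le _
        _ = 2 ^ (4 * k * (Nat.log 2 h + 1)) := by rw [← pow_mul]; ring_nf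
    have h2K : 2 * K ≤ 2 ^ (4 * k * (Nat.log 2 h + 1) + 1) := by rw [pow_succ]; omega
    have h6 : 6 * (4 * k * (Nat.log 2 h + 1) + 1) ≤ (Nat.log 2 h + C') ^ C' := by
      have e : 24 * k * (Nat.log 2 h + 1) = 6 * (4 * k * (Nat.log 2 h + 1)) := by ring
      omega
    calc 2 * K * 8 ^ ((Nat.log 2 h + C') ^ C')
        ≤ 2 ^ (4 * k * (Nat.log 2 h + 1) + 1) * 8 ^ ((Nat.log 2 h + C') ^ C') := Nat.mul_le_mul_right _ h2K
      _ ≤ 9 ^ ((Nat.log 2 h + C') ^ C') := two_pow_mul_eight_pow_le _ _ h6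
  have hlt := hlaw (4 ^ (c + 1) + c + 1) t ht1 hmt hKL hcount
  have hT := T_pow_four_le (c := c) hn0 hn4
  have hT2 : 2 ≤ 2 ^ ((Nat.log 2 n + c) ^ c) := by
    show 2 ^ 1 ≤ 2 ^ _
    exact Nat.pow_le_pow_right (by norm_num)
      (Nat.one_le_pow _ _ (by
        have h256 : 16 ^ 2 ≤ S₀ ^ 2 := Nat.pow_le_pow_left hS₀d 2
        have := Nat.log_pos one_lt_two (show 2 ≤ n by omega)
        omega))
  have h8 : 8 * 2 ^ ((Nat.log 2 n + c) ^ c) ≤ (2 ^ ((Nat.log 2 n + c) ^ c)) ^ 4 := by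
    have : 2 ^ 3 ≤ (2 ^ ((Nat.log 2 n + c) ^ c)) ^ 3 := Nat.pow_le_pow_left hT2 3
    calc 8 * 2 ^ ((Nat.log 2 n + c) ^ c) = 2 ^ 3 * 2 ^ ((Nat.log 2 n + c) ^ c) := by norm_num
      _ ≤ (2 ^ ((Nat.log 2 n + c) ^ c)) ^ 3 * 2 ^ ((Nat.log 2 n + c) ^ c) := Nat.mul_le_mul_right _ this
      _ = (2 ^ ((Nat.log 2 n + c) ^ c)) ^ 4 := by ring
  omega

/-! ## §4 The member theorem: sums of products of sparse factors -/

/-- over `ℝ≥0` the support of a sum is the union of the supports (no cancellation). [folklore] -/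
theorem support_sum_eq_biUnion {σ : Type} {K : ℕ} (P : Fin K → MvPolynomial σ ℝ≥0) [DecidableEq σ] :
    (∑ j, P j).support = Finset.univ.biUnion fun j => (P j).support := by
  classical
  ext d
  rw [MvPolynomial.mem_support_iff, MvPolynomial.coeff_sum, Finset.mem_biUnion]
  constructor
  · intro hne
    by_contra hall
    push Not at hall
    apply hne
    exact Finset.sum_eq_zero fun j _ => by
      have := hall j (Finset.mem_univ j)
      rwa [MvPolynomial.mem_support_iff, not_not] at this
  · rintro ⟨j, -, hj⟩ hzero
    rw [MvPolynomial.mem_support_iff] at hj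
    exact hj ((Finset.sum_eq_zero_iff.1 hzero) j (Finset.mem_univ j))

/-- hulls of unions agree when the hulls of the pieces agree. [folklore] -/
theorem convexHull_iUnion_eq_of_hull_eq {E : Type} [AddCommGroup E] [Module ℝ E] {K : ℕ} (A B : Fin K → Set E)
    (hAB : ∀ j, convexHull ℝ (A j) = convexHull ℝ (B j)) :
    convexHull ℝ (⋃ j, A j) = convexHull ℝ (⋃ j, B j) := by
  apply Set.Subset.antisymm
  · refine convexHull_min ?_ (convex_convexHull ℝ _)
    intro x hx
    obtain ⟨j, hj⟩ := Set.mem_iUnion.1 hx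
    have : x ∈ convexHull ℝ (B j) := by rw [← hAB j]; exact subset_convexHull ℝ _ hj
    exact convexHull_mono (Set.subset_iUnion B j) this
  · refine convexHull_min ?_ (convex_convexHull ℝ _)
    intro x hx
    obtain ⟨j, hj⟩ := Set.mem_iUnion.1 hx
    have : x ∈ convexHull ℝ (A j) := by rw [hAB j]; exact subset_convexHull ℝ _ hj
    exact convexHull_mono (Set.subset_iUnion A j) this

/-- ★★★ **SUMS OF POLYNOMIALLY MANY PRODUCTS OF SPARSE FACTORS ARE NOT CERTIFICATES (PROVED, unconditional):** for all `c k`, eventually in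
`n`, every `hh = Σ_{j<K} Π_{i<M} p_{j,i}` over `ℝ≥0` with all `p_{j,i} ≠ 0`, `|supp p_{j,i}| ≤ m` (`K, m ≥ 1`), `K ≤ n^k` and `K·M·m² ≤ n^k` satisfies
`2^((log₂ n + c)^c) < L₊(NN_n · hh) + L₊(hh)` — ANY degrees, ANY supports. [cite: HrubesYehudayoff2021, §6 Problem 2] -/
theorem nnDivisionHard_sum_prod_sparseFactors (c k : ℕ) : ∃ n₀ : ℕ, ∀ n ≥ n₀, ∀ (K M m : ℕ), 1 ≤ K → 1 ≤ m →
    K ≤ n ^ k → K * (M * (m * m)) ≤ n ^ k →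
    ∀ (p : Fin K → Fin M → MvPolynomial (Fin (2 * n) × Fin (2 * n)) ℝ≥0),
      (∀ j i, p j i ≠ 0) → (∀ j i, (p j i).support.card ≤ m) →
        2 ^ ((Nat.log 2 n + c) ^ c) <
          complexity (nestFreeMatchingPoly n ℝ≥0 * ∑ j, ∏ i, p j i) + complexity (∑ j, ∏ i, p j i) := by
  obtain ⟨n₀, hn₀⟩ := nnDivisionHard_unionSummands c k
  refine ⟨n₀, fun n hn K M m hK hm hKk hMk p hp0 hsupp => ?_⟩
  classical
  choose v hv using fun j i => exists_list_suppPts (p j i) (hp0 j i) (hsupp j i)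
  -- each product is nonzero, so the sum is nonzero
  have hprod_ne : ∀ j, ∏ i, p j i ≠ 0 := fun j => Finset.prod_ne_zero_iff.2 fun i _ => hp0 j i
  have hsum_ne : ∑ j, ∏ i, p j i ≠ 0 := by
    intro hzero
    have hsupp0 : (∑ j, ∏ i, p j i).support = ∅ := by rw [hzero]; exact MvPolynomial.support_zero
    rw [support_sum_eq_biUnion] at hsupp0
    have : (∏ i, p ⟨0, hK⟩ i).support = ∅ := Finset.eq_empty_of_forall_notMem fun d hd =>
      (Finset.eq_empty_iff_forall_notMem.1 hsupp0) d (Finset.mem_biUnion.2 ⟨⟨0, hK⟩, Finset.mem_univ _, hd⟩)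
    exact hprod_ne ⟨0, hK⟩ (MvPolynomial.support_eq_empty.1 this)
  refine hn₀ n hn _ hsum_ne hK hm v (fun _ => 0) ?_ hKk hMk
  -- `Newt(Σ_j Π_i p_ji) = conv(⋃_j range of the product family j)`
  have hprod : ∀ j, newtonPolytope (MvPolynomial.map NNReal.toRealHom (∏ i, p j i)) =
      convexHull ℝ (Set.range fun f : Fin M → Fin m => (0 : (Fin (2 * n) × Fin (2 * n)) → ℝ) + ∑ i, v j i (f i)) := by
    intro j
    rw [map_prod, newtonPolytope_prod]
    have hterm : ∀ i, newtonPolytope (MvPolynomial.map NNReal.toRealHom (p j i)) = convexHull ℝ (Set.range (v j i)) := by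
      intro i; rw [← newt_eq_newtonPolytope]; unfold newt; rw [hv j i]
    rw [Finset.sum_congr rfl fun i _ => hterm i, ← convexHull_sum, sum_range_eq_range_prodFamily]
    simp only [zero_add]
  have hNewtSum : newtonPolytope (MvPolynomial.map NNReal.toRealHom (∑ j, ∏ i, p j i)) =
      convexHull ℝ (⋃ j, suppPts (∏ i, p j i)) := by
    rw [← newt_eq_newtonPolytope]
    unfold newt suppPts
    rw [support_sum_eq_biUnion, Finset.coe_biUnion]
    simp only [Finset.coe_univ, Set.mem_univ, Set.iUnion_true, Set.image_iUnion]
  rw [hNewtSum]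
  have hpieces : ∀ j, convexHull ℝ (suppPts (∏ i, p j i)) =
      convexHull ℝ (Set.range fun f : Fin M → Fin m => (0 : (Fin (2 * n) × Fin (2 * n)) → ℝ) + ∑ i, v j i (f i)) := by
    intro j
    rw [← hprod j, ← newt_eq_newtonPolytope]
    rfl
  rw [convexHull_iUnion_eq_of_hull_eq _ _ hpieces]
  congr 1
  ext x
  simp only [Set.mem_iUnion, Set.mem_range, Prod.exists]

end Summands

end Summit.ValiantsHypothesis.ValiantsHypothesis.Theorems.FifoMatching

end
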